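import Literature.Geometry.Lorentzian.KelvinTransformAtInfinity
import Literature.Geometry.Lorentzian.LaplaceBeltramiChartForm
import Literature.Geometry.Lorentzian.DecaySymbolsCalculus
import Literature.Geometry.Lorentzian.HarmonicallyFlatADMProofs
import Literature.Geometry.Lorentzian.AsymptoticallyFlatCompleteness
import Literature.Geometry.Lorentzian.MassInequalities
import HarnessLib

/-!
# Harmonically flat ends are asymptotically flat to every order; the positive mass theorem for
# harmonically flat ends (Bray 2001, proof of Thm. 8, modulo the Riemannian PMT)

Bray, J. Differential Geom. 59 (2001) 177–267, proof of Thm. 8 (§6): after the harmonically flat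
reduction and the conformal compactification of the other ends one has a complete one-ended
manifold `(M̃, g̃)` with `R ≥ 0` whose end is *harmonically flat*, `g̃ = 𝒰⁴ δ` with `𝒰` harmonic
and `𝒰 → 1`, and *"then by the Riemannian positive mass theorem [41], the total mass `m̃` of
`(M̃³, g̃)` is nonnegative"*. To feed such an end to the tree's positive mass theorem
(`positive_mass_theorem_riemannian`, the Eichmair–Huang–Lee–Schoen form: asymptotic flatness of
order `1` in the `C²` sense, `C¹` decay of the sources, completeness, existence of the ADM limit)
one needs the classical **derivative decay of harmonic functions at infinity**: a function `V`
harmonic outside a ball of `ℝ³` with `V → 0` satisfies `|∂^α V(x)| = O(|x|^{-1-|α|})` for every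
multi-index (Gilbarg–Trudinger, Thm. 2.10, interior derivative estimates, on the balls
`B_{|x|/2}(x)`, combined with `|V| = O(|x|⁻¹)`, Folland Prop. (2.74); Folland Prop. (2.75) is the
radial first-order case). This file proves it and draws the consequences:

* `IsBigOSmooth.comp_contDiff` — symbol calculus: a symbol `f ∈ O_k(1)` (`‖∂ⁱf‖ = O(r⁻ⁱ)`)
  composed with a globally smooth map `g` is again in `O_k(1)` (Faà di Bruno in the form of
  Mathlib's `norm_iteratedFDerivWithin_comp_le`, as in `IsBigOSmooth.inv`);
* `isBigOSmooth_inversion_all` — the inversion `ι(x) = x/|x|²` is a symbol of order `-1` to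
  every order;
* `isBigOSmooth_of_harmonicOnNhd_of_tendsto_zero` — **the derivative decay**: `V ∈ O_k(r⁻¹)` for
  every `k`. *Proof (a shorter road than interior estimates, given the tree):* by the smooth
  Kelvin transform `W ∈ C^∞(ℝ³)` of `V` (`exists_contDiff_kelvinTransform_of_harmonicOnNhd`,
  `KelvinTransformAtInfinity.lean`), `V(x) = |x|⁻¹ W(ι x)` far out, and `|x|⁻¹ ∈ O_k(r⁻¹)`,
  `W ∘ ι ∈ O_k(1)` by the two lemmas above;
* for a harmonically flat end `e` (Bray's Def. 1, `AFEnd.IsHarmonicallyFlatWith e D R₁ U`) whose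
  factor tends to `1`, of time-symmetric data: `U - 1 ∈ O_k(r⁻¹)`
  (`isBigOSmooth_factor_sub`), `h - δ = (U⁴ - 1) δ ∈ O_k(r⁻¹)` (`isBigOSmooth_hCoeff_sub_innerSL`),
  hence `e.IsAsymptoticallyFlat D 1` (`isAsymptoticallyFlat_one`), `HasSourceDecay e D 1`
  (`hasSourceDecay`: `μ = R/16π = 0` and `J = 0` beyond `R₁`),
  `e.IsStronglyAsymptoticallyFlatWith D 0 0 0 0 0` and completeness of one-ended such data
  (`isComplete`, by `isComplete_of_isSoleEnd_holds`);
* `admEnergy_nonneg_of_positiveMass`, `coeff_nonneg_of_positiveMass`,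
  `harmonicallyFlatMass_nonneg_of_positiveMass` — **the positive mass theorem for harmonically
  flat ends, modulo `positive_mass_theorem_riemannian`** (taken as a hypothesis, it being an
  unproved named fact of the tree): for complete one-ended time-symmetric data with `R ≥ 0` and a
  harmonically flat end with `U = 1 + b/|x| + O(|x|⁻²)`, `0 ≤ E_ADM = 2b`, i.e. Bray's total mass
  `2ab` (Def. 2, `a = 1`) is nonnegative — the sentence of the proof of Thm. 8 quoted above.

Everything is proved; nothing is defined and no named fact is introduced.

## References

* H. L. Bray, *Proof of the Riemannian Penrose inequality using the positive mass theorem*,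
  J. Differential Geom. 59 (2001) 177–267 (arXiv:math/9911173), §2 Def. 1, (10), Def. 2; §6,
  proof of Thm. 8. [BrayRPI2001]
* D. Gilbarg, N. S. Trudinger, *Elliptic partial differential equations of second order* (2001),
  §2.7, Thm. 2.10 (interior estimates of derivatives of harmonic functions). [GilbargTrudinger2001]
* G. B. Folland, *Introduction to Partial Differential Equations*, 2nd ed., §2.I, Thm. (2.73),
  Prop. (2.74), Prop. (2.75). [Folland2020]
* M. Eichmair, L.-H. Huang, D. A. Lee, R. Schoen, *The spacetime positive mass theorem in
  dimensions less than eight*, J. Eur. Math. Soc. 18 (2016), Thm. 1 and §2. [EichmairHuangLeeSchoen2016]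
-/

noncomputable section

open Set Filter Asymptotics Bornology Metric Topology InnerProductSpace
open scoped Real ContDiff Manifold

namespace Literature.Geometry.Lorentzian

/-! ### Symbol calculus: composition with a smooth map, the inversion -/

namespace IsBigOSmooth

variable {E : Type*} [NormedAddCommGroup E] [NormedSpace ℝ E]
  {W : Type*} [NormedAddCommGroup W] [NormedSpace ℝ W]
  {W' : Type*} [NormedAddCommGroup W'] [NormedSpace ℝ W'] {k : ℕ}

/-- **Smooth functions of symbols of order `0`.** If `f ∈ O_k(1)` takes values in a proper space
`W` (so `‖∂ⁱ f(x)‖ = O(‖x‖⁻ⁱ)` for `i ≤ k`, and `f` is bounded far out) and `g : W → W'` is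
`C^∞`, then `g ∘ f ∈ O_k(1)`: by Faà di Bruno (Mathlib's `norm_iteratedFDerivWithin_comp_le`),
`‖∂^m (g ∘ f)(x)‖ ≤ m! · C · (C' ‖x‖⁻¹)^m` with `C` a bound for the derivatives of `g` of order
`≤ m` on the compact ball containing the far values of `f` and `‖∂ⁱ f(x)‖ ≤ (C' ‖x‖⁻¹)ⁱ` for
`1 ≤ i ≤ m`. (The case `g = z ↦ z⁻¹` is `IsBigOSmooth.inv`.) [folklore] -/
theorem comp_contDiff [ProperSpace W] {f : E → W} (hf : IsBigOSmooth k 0 f) {g : W → W'}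
    (hg : ContDiff ℝ ∞ g) : IsBigOSmooth k 0 fun y ↦ g (f y) := by
  obtain ⟨R₀, hR₀⟩ := hf.1
  -- `f` is bounded on a far region
  obtain ⟨C₀, -, hC₀⟩ := (hf.isBigO (m := 0) (Nat.zero_le _)).exists_pos
  have hval : ∀ᶠ x in cobounded E, ‖f x‖ ≤ C₀ := by
    filter_upwards [hC₀.bound] with x hx
    simpa only [norm_norm, norm_iteratedFDeriv_zero, Nat.cast_zero, sub_zero, Real.rpow_zero,
      norm_one, mul_one] using hx
  obtain ⟨R₁, hR₁⟩ := exists_radius_of_eventually_cobounded hval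
  set s : Set E := {y | max R₀ R₁ < ‖y‖} with hs_def
  have hs : IsOpen s := isOpen_setOf_lt_norm _
  have hfs : ContDiffOn ℝ ∞ f s := hR₀.mono (setOf_lt_norm_anti (le_max_left _ _))
  have hfval : ∀ y ∈ s, f y ∈ closedBall (0 : W) C₀ := fun y hy ↦
    mem_closedBall_zero_iff.2 (hR₁ y (lt_of_le_of_lt (le_max_right _ _) hy))
  refine ⟨⟨max R₀ R₁, hg.comp_contDiffOn hfs⟩, fun m hm ↦ ?_⟩
  -- bounds for the derivatives of `g` on the compact ball `‖z‖ ≤ C₀`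
  have hK : IsCompact (closedBall (0 : W) C₀) := isCompact_closedBall _ _
  have hCi : ∀ i : ℕ, ∃ C : ℝ, ∀ z ∈ closedBall (0 : W) C₀,
      ‖iteratedFDerivWithin ℝ i g univ z‖ ≤ C := fun i ↦ by
    obtain ⟨C, hC⟩ := hK.exists_bound_of_continuousOn
      ((hg.continuous_iteratedFDeriv (natCast_le_infty i)).continuousOn)
    exact ⟨C, fun z hz ↦ by rw [iteratedFDerivWithin_univ]; exact hC z hz⟩
  choose C hC using hCi
  set Cm : ℝ := ∑ i ∈ Finset.range (m + 1), |C i| with hCm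
  have hCm_bound : ∀ i, i ≤ m → ∀ z ∈ closedBall (0 : W) C₀,
      ‖iteratedFDerivWithin ℝ i g univ z‖ ≤ Cm := by
    intro i hi z hz
    refine ((hC i z hz).trans (le_abs_self _)).trans ?_
    exact Finset.single_le_sum (f := fun i ↦ |C i|) (fun _ _ ↦ abs_nonneg _)
      (Finset.mem_range.2 (Nat.lt_succ_of_le hi))
  -- bounds `‖∂^i f(x)‖ ≤ (C' ‖x‖⁻¹)^i` for `1 ≤ i ≤ m`, eventually
  have hci : ∀ i ∈ Finset.range (m + 1), ∃ c : ℝ, 0 < c ∧ ∀ᶠ x in cobounded E,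
      ‖iteratedFDeriv ℝ i f x‖ ≤ c * ‖x‖ ^ (-(i : ℝ)) := by
    intro i hi
    have him : i ≤ k := (Nat.lt_succ_iff.1 (Finset.mem_range.1 hi)).trans hm
    obtain ⟨c, hc, h⟩ := (hf.isBigO him).exists_pos
    refine ⟨c, hc, ?_⟩
    filter_upwards [h.bound, eventually_cobounded_lt_norm (E := E) 0] with x hx hx0
    rw [norm_norm, Real.norm_of_nonneg (Real.rpow_nonneg (norm_nonneg _) _), zero_sub] at hx
    exact hx
  choose! c hc0 hc using hci
  set C' : ℝ := 1 + ∑ i ∈ Finset.range (m + 1), c i with hC'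
  have hcsum : ∀ i ∈ Finset.range (m + 1), c i ≤ ∑ j ∈ Finset.range (m + 1), c j := fun i hi ↦
    Finset.single_le_sum (f := c) (fun j hj ↦ (hc0 j hj).le) hi
  have hC'1 : 1 ≤ C' := by
    have : 0 ≤ ∑ j ∈ Finset.range (m + 1), c j := Finset.sum_nonneg fun j hj ↦ (hc0 j hj).le
    linarith
  have hall : ∀ᶠ x in cobounded E, ∀ i ∈ Finset.range (m + 1),
      ‖iteratedFDeriv ℝ i f x‖ ≤ c i * ‖x‖ ^ (-(i : ℝ)) :=
    (Finset.eventually_all _).2 fun i hi ↦ hc i hi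
  -- the estimate on the far region
  have H : ∀ᶠ x in cobounded E, ‖iteratedFDeriv ℝ m (fun y ↦ g (f y)) x‖ ≤
      (m.factorial * Cm * C' ^ m) * ‖x‖ ^ ((0 : ℝ) - m) := by
    filter_upwards [hall, eventually_cobounded_lt_norm (E := E) (max R₀ R₁),
      eventually_cobounded_le_norm (E := E) 1] with x hx hxs hx1
    have hxpos : 0 < ‖x‖ := by linarith
    have hxs' : x ∈ s := hxs
    have hD : ∀ i, 1 ≤ i → i ≤ m → ‖iteratedFDerivWithin ℝ i f s x‖ ≤ (C' * ‖x‖⁻¹) ^ i := by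
      intro i hi1 him
      have hi : i ∈ Finset.range (m + 1) := Finset.mem_range.2 (Nat.lt_succ_of_le him)
      rw [iteratedFDerivWithin_of_isOpen i hs hxs']
      calc ‖iteratedFDeriv ℝ i f x‖ ≤ c i * ‖x‖ ^ (-(i : ℝ)) := hx i hi
        _ ≤ C' ^ i * ‖x‖ ^ (-(i : ℝ)) := by
            gcongr
            calc c i ≤ C' := by linarith [hcsum i hi]
              _ ≤ C' ^ i := le_self_pow₀ hC'1 (by omega)
        _ = (C' * ‖x‖⁻¹) ^ i := by
            rw [mul_pow, Real.rpow_neg hxpos.le, Real.rpow_natCast, inv_pow]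
    have hCb : ∀ i, i ≤ m → ‖iteratedFDerivWithin ℝ i g univ (f x)‖ ≤ Cm :=
      fun i hi ↦ hCm_bound i hi (f x) (hfval x hxs')
    have key := norm_iteratedFDerivWithin_comp_le (g := g) (f := f) (n := m)
      hg.contDiffOn hfs (natCast_le_infty m) uniqueDiffOn_univ hs.uniqueDiffOn
      (mapsTo_univ f s) hxs' hCb hD
    rw [iteratedFDerivWithin_of_isOpen m hs hxs'] at key
    calc ‖iteratedFDeriv ℝ m (fun y ↦ g (f y)) x‖ = ‖iteratedFDeriv ℝ m (g ∘ f) x‖ := rfl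
      _ ≤ m.factorial * Cm * (C' * ‖x‖⁻¹) ^ m := key
      _ = (m.factorial * Cm * C' ^ m) * ‖x‖ ^ ((0 : ℝ) - m) := by
          rw [mul_pow, zero_sub, Real.rpow_neg hxpos.le, Real.rpow_natCast, inv_pow]
          ring
  exact (IsBigO.of_norm_eventuallyLE
    (H.mono fun x hx ↦ (Real.norm_of_nonneg (norm_nonneg _)).trans_le hx)).trans
    ((isBigO_refl _ _).const_mul_left _)

end IsBigOSmooth

section Inversion

variable {E : Type*} [NormedAddCommGroup E]

/-- Faster power decay is negligible against slower power decay at infinity: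
`‖x‖ ^ p = o(‖x‖ ^ q)` along `Bornology.cobounded` for `p < q`. [folklore] -/
theorem isLittleO_norm_rpow_rpow_cobounded {p q : ℝ} (h : p < q) :
    (fun x : E ↦ ‖x‖ ^ p) =o[cobounded E] fun x ↦ ‖x‖ ^ q := by
  have h1 : Tendsto (fun x : E ↦ ‖x‖ ^ (p - q)) (cobounded E) (𝓝 0) := by
    have h' : Tendsto (fun x : E ↦ ‖x‖ ^ (-(q - p))) (cobounded E) (𝓝 0) :=
      (tendsto_rpow_neg_atTop (by linarith)).comp tendsto_norm_cobounded_atTop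
    refine h'.congr fun x ↦ ?_
    rw [neg_sub]
  have h2 : (fun x : E ↦ ‖x‖ ^ (p - q)) =o[cobounded E] fun _ ↦ (1 : ℝ) :=
    (isLittleO_one_iff ℝ).2 h1
  have h3 := h2.mul_isBigO (isBigO_refl (fun x : E ↦ ‖x‖ ^ q) (cobounded E))
  refine h3.congr' ((norm_rpow_mul_rpow_eventuallyEq (E := E) (p - q) q).trans ?_) ?_
  · exact Eventually.of_forall fun x ↦ by rw [sub_add_cancel]
  · exact Eventually.of_forall fun x ↦ one_mul _

variable {E' : Type*} [NormedAddCommGroup E'] [InnerProductSpace ℝ E']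

/-- **The inversion `ι(x) = x/|x|²` is a symbol of order `-1` to every order**: it is the product
of the symbols `r⁻¹ · r⁻¹ ∈ O_k(r⁻²)` (`isBigOSmooth_inv_norm_all`) and `x ↦ x ∈ O_k(r)`.
Folland, §2.I (the map `x ↦ |x|⁻² x` of the Kelvin transform). [folklore] -/
theorem isBigOSmooth_inversion_all (k : ℕ) :
    IsBigOSmooth k (-1) fun y : E' ↦ (‖y‖ ^ 2)⁻¹ • y := by
  have h1 := isBigOSmooth_inv_norm_all (E' := E') k
  have h := (h1.mul h1).smul (isBigOSmooth_clm_apply (ContinuousLinearMap.id ℝ E') k)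
  rw [show (-1 : ℝ) + -1 + 1 = -1 by norm_num] at h
  refine h.congr fun y ↦ ?_
  show (‖y‖⁻¹ * ‖y‖⁻¹) • (ContinuousLinearMap.id ℝ E') y = (‖y‖ ^ 2)⁻¹ • y
  rw [ContinuousLinearMap.id_apply, ← mul_inv, ← sq]

/-- The inversion reads `‖ι(x)‖ = ‖x‖⁻¹`. Folland, §2.I. [folklore] -/
theorem norm_inversion_sq_smul (x : E') : ‖(‖x‖ ^ 2)⁻¹ • x‖ = ‖x‖⁻¹ := by
  rcases eq_or_ne x 0 with rfl | hx
  · simp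
  · have hx0 : ‖x‖ ≠ 0 := norm_ne_zero_iff.2 hx
    rw [norm_smul, norm_inv, norm_pow, Real.norm_of_nonneg (norm_nonneg _)]
    field_simp

/-- The inversion is an involution away from the origin: `ι(ι(x)) = x`. Folland, §2.I.
[folklore] -/
theorem inversion_sq_smul_inversion_sq_smul {x : E'} (hx : x ≠ 0) :
    (‖(‖x‖ ^ 2)⁻¹ • x‖ ^ 2)⁻¹ • ((‖x‖ ^ 2)⁻¹ • x) = x := by
  have hx0 : ‖x‖ ≠ 0 := norm_ne_zero_iff.2 hx
  rw [norm_inversion_sq_smul, smul_smul, inv_pow, inv_inv, mul_inv_cancel₀ (pow_ne_zero 2 hx0),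
    one_smul]

end Inversion

/-! ### Derivative decay of harmonic functions at infinity -/

section HarmonicDecay

/-- **Derivatives of a function harmonic at infinity decay one order faster per derivative.**
If `V : ℝ³ → ℝ` is harmonic on `{R₁ < |x|}` and `V → 0` at infinity, then for every `k`,
`V ∈ O_k(r⁻¹)`: `V` is smooth far out and `‖∂^m V(x)‖ = O(|x|^{-1-m})` for all `m ≤ k`.
Classically: `|V(x)| = O(|x|⁻¹)` (Folland, Prop. (2.74)) and the interior derivative estimates
for harmonic functions on the balls `B_{|x|/2}(x)` (Gilbarg–Trudinger, Thm. 2.10: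
`|D^α u| ≤ (n|α|/d)^{|α|} sup |u|`); Folland, Prop. (2.75) is the radial first-order case. Here:
`V(x) = |x|⁻¹ W(x/|x|²)` beyond `1/ρ` with the smooth Kelvin transform `W ∈ C^∞(ℝ³)`
(`exists_contDiff_kelvinTransform_of_harmonicOnNhd`), `|x|⁻¹ ∈ O_k(r⁻¹)`,
`x/|x|² ∈ O_k(r⁻¹) ⊆ O_k(1)` and `W ∘ ι ∈ O_k(1)` (`IsBigOSmooth.comp_contDiff`).
[cite: GilbargTrudinger2001, §2.7 Thm. 2.10] [cite: Folland2020, §2.I Prop. (2.74)–(2.75)] -/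
theorem isBigOSmooth_of_harmonicOnNhd_of_tendsto_zero {R₁ : ℝ} {V : E3 → ℝ}
    (hV : HarmonicOnNhd V {x : E3 | R₁ < ‖x‖}) (hV0 : Tendsto V (cobounded E3) (𝓝 0)) (k : ℕ) :
    IsBigOSmooth k (-1) V := by
  obtain ⟨W, ρ, b, hW, hρ, hWV, -, -, -⟩ :=
    exists_contDiff_kelvinTransform_of_harmonicOnNhd R₁ V hV hV0
  have hι : IsBigOSmooth k 0 fun x : E3 ↦ (‖x‖ ^ 2)⁻¹ • x :=
    (isBigOSmooth_inversion_all (E' := E3) k).mono (by norm_num)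
  have hWι : IsBigOSmooth k 0 fun x : E3 ↦ W ((‖x‖ ^ 2)⁻¹ • x) := hι.comp_contDiff hW
  have h := (isBigOSmooth_inv_norm_all (E' := E3) k).smul hWι
  rw [add_zero] at h
  refine h.congr_far (R₁ := ρ⁻¹) fun x hx ↦ ?_
  have hx0 : 0 < ‖x‖ := (inv_pos.2 hρ).trans hx
  have hxne : x ≠ 0 := norm_pos_iff.1 hx0
  have hy0 : (‖x‖ ^ 2)⁻¹ • x ≠ 0 := by
    rw [← norm_pos_iff, norm_inversion_sq_smul]
    exact inv_pos.2 hx0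
  have hyρ : ‖(‖x‖ ^ 2)⁻¹ • x‖ < ρ := by
    rw [norm_inversion_sq_smul]
    exact (inv_lt_comm₀ hx0 hρ).2 hx
  show ‖x‖⁻¹ • W ((‖x‖ ^ 2)⁻¹ • x) = V x
  rw [hWV _ hy0 hyρ, inversion_sq_smul_inversion_sq_smul hxne, norm_inversion_sq_smul, inv_inv,
    smul_eq_mul, ← mul_assoc, inv_mul_cancel₀ hx0.ne', one_mul]

/-- A function harmonic on a far region and tending to a constant `a` is `a + O_k(r⁻¹)` for
every `k` (the previous theorem for `V - a`). Bray 2001, §2, (10) with all derivatives.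
[cite: BrayRPI2001, §2 (10)] -/
theorem isBigOSmooth_sub_const_of_harmonicOnNhd {R₁ : ℝ} {U : E3 → ℝ} {a : ℝ}
    (hU : HarmonicOnNhd U {x : E3 | R₁ < ‖x‖}) (ha : Tendsto U (cobounded E3) (𝓝 a)) (k : ℕ) :
    IsBigOSmooth k (-1) fun x ↦ U x - a := by
  have hV : HarmonicOnNhd (fun x ↦ U x - a) {x : E3 | R₁ < ‖x‖} := fun x hx ↦
    (hU x hx).sub (harmonicAt_const a)
  have hV0 : Tendsto (fun x ↦ U x - a) (cobounded E3) (𝓝 0) := by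
    simpa using ha.sub_const a
  exact isBigOSmooth_of_harmonicOnNhd_of_tendsto_zero hV hV0 k

end HarmonicDecay

/-! ### Harmonically flat ends are asymptotically flat -/

namespace AFEnd

variable {X : Type*} [TopologicalSpace X] [ChartedSpace E3 X] [IsManifold (𝓡 3) ∞ X]
  {e : AFEnd X} {D : InitialDataSet (𝓡 3) X}

/-- For time-symmetric data (`k = 0`) the chart components of `k` vanish identically (the
pullback of the zero form is zero; `0` is also the junk value inside the ball).
Christodoulou–Klainerman 1993, (1.0.9b) with vanishing `k`. [folklore] -/
theorem kCoeff_eq_zero_of_isTimeSymmetric (hts : D.IsTimeSymmetric) (x : E3) :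
    kCoeff e D x = 0 := by
  unfold kCoeff
  split_ifs with hx
  · ext v w
    rw [pullbackBilin_apply, hts]
    rfl
  · rfl

namespace IsHarmonicallyFlatWith

variable [D.metric.HasLeviCivita] {R₁ : ℝ} {U : E3 → ℝ}

/-- **The conformal factor of a harmonically flat end is `a + O_k(r⁻¹)` to every order** (`U` is
harmonic beyond `R₁` and tends to `a`). Bray 2001, §2, (10) (the expansion; here with all
derivatives, Gilbarg–Trudinger Thm. 2.10). [cite: BrayRPI2001, §2 (10)] -/
theorem isBigOSmooth_factor_sub (hU : e.IsHarmonicallyFlatWith D R₁ U) {a : ℝ}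
    (ha : Tendsto U (cobounded E3) (𝓝 a)) (k : ℕ) : IsBigOSmooth k (-1) fun x ↦ U x - a :=
  isBigOSmooth_sub_const_of_harmonicOnNhd hU.harmonicOnNhd ha k

/-- The conformal factor of a harmonically flat end is a symbol of order `0` to every order.
Bray 2001, §2, (10). [cite: BrayRPI2001, §2 (10)] -/
theorem isBigOSmooth_factor (hU : e.IsHarmonicallyFlatWith D R₁ U) (k : ℕ) :
    IsBigOSmooth k 0 U := by
  obtain ⟨a, -, ha⟩ := hU.exists_tendsto
  have h := (isBigOSmooth_const k a).add ((hU.isBigOSmooth_factor_sub ha k).mono (by norm_num))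
  exact h.congr fun y ↦ by simp

/-- **`h - δ = (U⁴ - 1) δ ∈ O_k(r⁻¹)` for a harmonically flat end whose factor tends to `1`**:
`U⁴ - 1 = (1 + V)⁴ - 1⁴` with `V = U - 1 ∈ O_k(r⁻¹)` (`IsBigOSmooth.add_pow_four_sub_pow_four`),
and `hCoeff = U⁴ δ` beyond `R₁` (Def. 1, (9)). Bray 2001, §2, Def. 1 with (9)–(10).
[cite: BrayRPI2001, §2 Def. 1 with (9)–(10)] -/
theorem isBigOSmooth_hCoeff_sub_innerSL (hU : e.IsHarmonicallyFlatWith D R₁ U)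
    (h1 : Tendsto U (cobounded E3) (𝓝 1)) (k : ℕ) :
    IsBigOSmooth k (-1) fun y ↦ hCoeff e D y - (innerSL ℝ (E := E3) : E3 →L[ℝ] E3 →L[ℝ] ℝ) := by
  have hV := hU.isBigOSmooth_factor_sub h1 k
  have h4 : IsBigOSmooth k (-1) fun y ↦ (1 + (U y - 1)) ^ 4 - 1 ^ 4 :=
    (isBigOSmooth_const k (1 : ℝ)).add_pow_four_sub_pow_four hV (by norm_num)
  have h := h4.smul_const (innerSL ℝ (E := E3) : E3 →L[ℝ] E3 →L[ℝ] ℝ)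
  refine h.congr_far (R₁ := R₁) fun y hy ↦ ?_
  show ((1 + (U y - 1)) ^ 4 - 1 ^ 4) • (innerSL ℝ (E := E3) : E3 →L[ℝ] E3 →L[ℝ] ℝ) =
    hCoeff e D y - innerSL ℝ (E := E3)
  rw [hU.hCoeff_eq hy, show (1 : ℝ) + (U y - 1) = U y by ring, one_pow, sub_smul, one_smul]

/-- **A harmonically flat end whose factor tends to `1` is asymptotically flat of order `1`**
(`h - δ = O₂(r⁻¹)`, and `k = O₁(r⁻²)` trivially for time-symmetric data) — the metric
hypothesis of the positive mass theorem in the form `positive_mass_theorem_riemannian`.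
Bray 2001, §6, proof of Thm. 8 ("by the Riemannian positive mass theorem [41], the total mass
`m̃` of `(M̃³, g̃)` is nonnegative", applied to a harmonically flat end).
[cite: BrayRPI2001, §6 proof of Thm. 8] -/
theorem isAsymptoticallyFlat_one (hU : e.IsHarmonicallyFlatWith D R₁ U)
    (h1 : Tendsto U (cobounded E3) (𝓝 1)) (hts : D.IsTimeSymmetric) :
    e.IsAsymptoticallyFlat D 1 := by
  refine ⟨fun m hm ↦ ?_, fun m _ ↦ ?_⟩
  · have h := (hU.isBigOSmooth_hCoeff_sub_innerSL h1 2).isBigO hm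
    refine h.congr_right fun x ↦ ?_
    norm_num
  · have h0 : kCoeff e D = fun _ ↦ 0 := funext (kCoeff_eq_zero_of_isTimeSymmetric hts)
    rw [h0]
    refine IsBigO.of_bound 0 (Eventually.of_forall fun x ↦ ?_)
    simp

/-- **A harmonically flat end whose factor tends to `1` is strongly asymptotically flat to order
zero** (`h - δ = o(1)`, `k = 0`; mass parameter `0`, rates `β = γ = 0`, no derivatives) — the
hypothesis of the completeness fact `isComplete_of_isSoleEnd`. Bray 2001, §2, Def. 1 with (10).
[cite: BrayRPI2001, §2 Def. 1 with (10)] -/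
theorem isStronglyAsymptoticallyFlatWith_zero (hU : e.IsHarmonicallyFlatWith D R₁ U)
    (h1 : Tendsto U (cobounded E3) (𝓝 1)) (hts : D.IsTimeSymmetric) :
    e.IsStronglyAsymptoticallyFlatWith D 0 0 0 0 0 := by
  refine ⟨fun m hm ↦ ?_, fun m _ ↦ ?_⟩
  · obtain rfl : m = 0 := Nat.le_zero.1 hm
    have hH := (hU.isBigOSmooth_hCoeff_sub_innerSL h1 0).isBigO (m := 0) le_rfl
    have hfun : (fun y ↦ hCoeff e D y - (1 + 2 * (0 : ℝ) / ‖y‖) •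
        (innerSL ℝ (E := E3) : E3 →L[ℝ] E3 →L[ℝ] ℝ)) =
        fun y ↦ hCoeff e D y - (innerSL ℝ (E := E3) : E3 →L[ℝ] E3 →L[ℝ] ℝ) := by
      funext y
      simp
    rw [hfun]
    refine hH.trans_isLittleO ?_
    refine (isLittleO_norm_rpow_rpow_cobounded (E := E3) ?_)
    norm_num
  · have h0 : kCoeff e D = fun _ ↦ 0 := funext (kCoeff_eq_zero_of_isTimeSymmetric hts)
    rw [h0]
    refine IsLittleO.of_bound fun c _ ↦ Eventually.of_forall fun x ↦ ?_
    have : iteratedFDeriv ℝ m (fun _ : E3 ↦ (0 : E3 →L[ℝ] E3 →L[ℝ] ℝ)) x = 0 := by simp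
    rw [this, norm_zero, norm_zero]
    positivity

end IsHarmonicallyFlatWith

end AFEnd

/-! ### Source decay (the sources vanish beyond `R₁`) -/

section SourceDecay

variable {X : Type} [TopologicalSpace X] [ChartedSpace E3 X] [IsManifold (𝓡 3) ∞ X]
  {D : InitialDataSet (𝓡 3) X} [D.metric.HasLeviCivita] {e : AFEnd X} {R₁ : ℝ} {U : E3 → ℝ}

/-- **Source decay on a harmonically flat end** of time-symmetric data, with rate `q₀ = 1` (any
rate would do): beyond `R₁` the scalar curvature vanishes (Def. 1), so `μ = R/(16π) = 0` there,
and `J = 0` since `k = 0`. Bray 2001, §2, Def. 1 ("zero scalar curvature" in each end).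
[cite: BrayRPI2001, §2 Def. 1] -/
theorem AFEnd.IsHarmonicallyFlatWith.hasSourceDecay (hU : e.IsHarmonicallyFlatWith D R₁ U)
    (hts : D.IsTimeSymmetric) :
    HasSourceDecay e D 1 := by
  refine ⟨one_pos, fun m hm ↦ ?_, fun i m _ ↦ ?_⟩
  · have hz : IsBigOSmooth 1 (-3 - 1) (energyDensityCoeff e D) :=
      (isBigOSmooth_zero 1 _).congr_far (R₁ := R₁) fun y hy ↦ by
        rw [energyDensityCoeff_of_isTimeSymmetric e hts, hU.scalarCurvatureCoeff_eq_zero hy,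
          mul_zero]
    exact hz.isBigO hm
  · have h0 : momentumDensityCoeff e D i = fun _ ↦ 0 :=
      funext (momentumDensityCoeff_of_isTimeSymmetric e hts i)
    rw [h0]
    refine IsBigO.of_bound 0 (Eventually.of_forall fun x ↦ ?_)
    simp

end SourceDecay

/-! ### Completeness and the positive mass theorem for harmonically flat ends -/

section PositiveMass

variable {X : Type} [TopologicalSpace X] [ChartedSpace E3 X] [IsManifold (𝓡 3) ∞ X]
  [T2Space X] [SecondCountableTopology X] [ConnectedSpace X]
  {D : InitialDataSet (𝓡 3) X} [D.metric.HasLeviCivita] {e : AFEnd X} {R₁ : ℝ} {U : E3 → ℝ}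

/-- **One-ended time-symmetric data with a harmonically flat end (factor `→ 1`) are complete**
(`isComplete_of_isSoleEnd_holds` with the order-zero decay `isStronglyAsymptoticallyFlatWith_zero`).
This is the completeness Bray assumes throughout (§2, Lemma 1: "complete"; Thm. 8: "complete").
[cite: BrayRPI2001, §6 Thm. 8] -/
theorem AFEnd.IsHarmonicallyFlatWith.isComplete (hU : e.IsHarmonicallyFlatWith D R₁ U)
    (h1 : Tendsto U (cobounded E3) (𝓝 1)) (hts : D.IsTimeSymmetric) (hsole : e.IsSoleEnd) :
    D.IsComplete :=
  isComplete_of_isSoleEnd_holds X D e 0 0 0 0 0 le_rfl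
    (hU.isStronglyAsymptoticallyFlatWith_zero h1 hts) hsole

/-- **The positive mass theorem for a harmonically flat end, modulo the Riemannian positive mass
theorem** (Bray 2001, §6, proof of Thm. 8: *"then by the Riemannian positive mass theorem [41],
the total mass `m̃` of `(M̃³, g̃)` is nonnegative"*): for time-symmetric data on a connected
Hausdorff second-countable `3`-manifold with `R(h) ≥ 0`, whose only end `e` is harmonically flat
with factor tending to `1`, the ADM energy is nonnegative — given the named fact
`positive_mass_theorem_riemannian` (Eichmair–Huang–Lee–Schoen 2016, Thm. 1, unproved in the tree
and therefore a hypothesis here), all of whose hypotheses the end satisfies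
(`isAsymptoticallyFlat_one`, `hasSourceDecay`, `isComplete`, and the ADM limit
`IsHarmonicallyFlatWith.hasADMEnergy` with the expansion (10) from
`Bray2001_harmonicFactor_expansion_holds`).
[cite: BrayRPI2001, §6 proof of Thm. 8] [cite: EichmairHuangLeeSchoen2016, Thm. 1] -/
theorem AFEnd.IsHarmonicallyFlatWith.admEnergy_nonneg_of_positiveMass
    (hPMT : positive_mass_theorem_riemannian) (hU : e.IsHarmonicallyFlatWith D R₁ U)
    (h1 : Tendsto U (cobounded E3) (𝓝 1)) (hts : D.IsTimeSymmetric) (hsole : e.IsSoleEnd)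
    (hR : ∀ x : X, 0 ≤ D.metric.scalarCurvature x) : 0 ≤ e.admEnergy D := by
  obtain ⟨b, hb⟩ := Bray2001_harmonicFactor_expansion_holds R₁ U 1 hU.harmonicOnNhd h1
  exact hPMT X D e hts (hU.isAsymptoticallyFlat_one h1 hts) ⟨1, hU.hasSourceDecay hts⟩ hsole
    (hU.isComplete h1 hts hsole) hR ⟨2 * b, hU.hasADMEnergy hb⟩

/-- **The monopole coefficient of a harmonically flat end is nonnegative, modulo the PMT**: with
`U = 1 + b/|x| + O(|x|⁻²)` on the only end of complete time-symmetric data with `R ≥ 0`,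
`0 ≤ b` (the ADM energy is `2b`, `IsHarmonicallyFlatWith.hasADMEnergy`). Bray 2001, §6, proof
of Thm. 8 (`m̃ ≥ 0`), with §2, Def. 2 (`m = 2ab`). [cite: BrayRPI2001, §6 proof of Thm. 8] -/
theorem AFEnd.IsHarmonicallyFlatWith.coeff_nonneg_of_positiveMass
    (hPMT : positive_mass_theorem_riemannian) (hU : e.IsHarmonicallyFlatWith D R₁ U) {b : ℝ}
    (hb : HasHarmonicExpansion U 1 b) (hts : D.IsTimeSymmetric) (hsole : e.IsSoleEnd)
    (hR : ∀ x : X, 0 ≤ D.metric.scalarCurvature x) : 0 ≤ b := by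
  have h := hU.admEnergy_nonneg_of_positiveMass hPMT hb.tendsto hts hsole hR
  rw [(hU.hasADMEnergy hb).admEnergy_eq] at h
  linarith

/-- **Bray's total mass of a harmonically flat end is nonnegative, modulo the PMT** (Def. 2 form):
if the only end `e` of complete time-symmetric data with `R ≥ 0` is harmonically flat with total
mass `m = 2ab` and its conformal factor tends to `1`, then `0 ≤ m`. Bray 2001, §6, proof of
Thm. 8, with §2, Def. 2. [cite: BrayRPI2001, §6 proof of Thm. 8] -/
theorem AFEnd.harmonicallyFlatMass_nonneg_of_positiveMass
    (hPMT : positive_mass_theorem_riemannian) {m : ℝ} (hm : e.HasHarmonicallyFlatMass D m)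
    (h1 : ∃ (R₁ : ℝ) (U : E3 → ℝ), e.IsHarmonicallyFlatWith D R₁ U ∧
      Tendsto U (cobounded E3) (𝓝 1))
    (hts : D.IsTimeSymmetric) (hsole : e.IsSoleEnd)
    (hR : ∀ x : X, 0 ≤ D.metric.scalarCurvature x) : 0 ≤ m := by
  have hE : e.HasADMEnergy D m := Bray2001_harmonicallyFlatMass_hasADMEnergy_holds X D e m hm h1
  obtain ⟨R₁, U, hU, hU1⟩ := h1
  have h := hU.admEnergy_nonneg_of_positiveMass hPMT hU1 hts hsole hR
  rwa [hE.admEnergy_eq] at h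

end PositiveMass

end Literature.Geometry.Lorentzian

end
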